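import Summits.CriticalPhenomena.PercolationContinuityZ3.Theorems.Transplant.BenjaminiSchrammKnownCases
import Summits.CriticalPhenomena.PercolationContinuityZ3.Theorems.Transplant.StatementPolynomialGrowth
import Literature.Barriers.CriticalPhenomena.BLPSCriticalReduction
import HarnessLib

/-!
# Benjamini–Schramm Conjecture 4 IS its amenable–subexponential residue:
# **`conj4_iff_amenableSubexponential : BenjaminiSchramm1996_conj4 ↔ BenjaminiSchramm1996_conj4_amenableSubexponential`**

The lane filed three spellings of Benjamini–Schramm's Conjecture 4 as `@[conjecture]` nodes (stmt seat, p207114 / p207391): the conjecture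
itself `BenjaminiSchramm1996_conj4` (every connected, locally finite, quasi-transitive graph with `p_c < 1` has `θ(p_c) = 0`), its restriction
`…_polynomialGrowth` to graphs of uniform polynomial growth (class C2), and its restriction `…_amenableSubexponential` to AMENABLE graphs
WITHOUT exponential growth (class C3, "the open residue in print").  This file records, as kernel theorems, the exact logical position of the
three nodes given the tree's PROVED cases:
* **`conj4_iff_amenableSubexponential`** — the full conjecture is EQUIVALENT to the C3 residue: a quasi-transitive graph either has exponential
  growth, where Conj. 4 is Hutchcroft's theorem (tree: `Hutchcroft2016_noPercolationAtCriticality_holds`, in Conj-4 shape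
  `conj4_case_exponentialGrowth`, p207415), or it has not, and then it is amenable (nonamenable quasi-transitive graphs grow exponentially,
  Lyons–Peres §6.1, tree `hasExponentialGrowth_of_not_isGraphAmenable`) — so the two extra hypotheses of the residue are exactly the
  complement of the proved case;
* `conj4_polynomialGrowth_of_conj4_amenableSubexponential` — C3 ⊇ C2 (uniform polynomial growth excludes exponential growth,
  `not_hasExponentialGrowth_of_polynomialGrowth`, any real exponent), hence `conj4_polynomialGrowth_of_conj4`; the converse C2 ⇒ C3 is NOT
  claimed (intermediate growth).
Nothing here asserts any of the three conjectures.  The lane's unconditional instances INSIDE C2 (H₃(ℤ), H₃(ℤ)×ℤ^k, H_{2k+1}, Cay(H₃;S), every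
`PlanarSkeletonConc` graph, …) are recorded in `SkelConcHolds` and its customers.

builds on p205010 (kernel theorem, internal audit signed; external expert review pending): NOT used by any theorem of this file (the import of
`BenjaminiSchrammKnownCases` carries p205010 in its closure for `conj4_case_zd`, which is not referenced here); the reductions rest on
Hutchcroft 2016 and Lyons–Peres §6.1 as proved in the tree.
Status sentence (coordinator 2026-08-20T04:30Z): "θ(p_c) = 0 on ℤ^d, all d ≥ 2 — kernel-verified (Lean 4/Mathlib, standard axioms); internal
adversarial audit SIGNED 2026-08-20 04:29Z; external expert review pending."
Lane `prim-bschramm-*`, seat `prim-bschramm-stmt` (gen 10); helper file (`--supports stmt-CriticalPhenomena-4575`).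
[cite: BenjaminiSchramm1996, Conj. 4] [cite: Hutchcroft2016, Thm. 1] [cite: LyonsPeres2016, §6.1 (p. 279)] [cite: HermonHutchcroft2021, §1]
-/

noncomputable section

open Filter
open scoped Classical Topology

namespace Summit.CriticalPhenomena.PercolationContinuityZ3.Theorems.Transplant

open Literature.Probability.Percolation Literature.Probability.LatticeModels SimpleGraph
open Literature.Barriers.CriticalPhenomena

/-! ## §1 Uniform polynomial growth excludes exponential growth (any real exponent) -/

/-- **Uniform polynomial growth excludes exponential growth**: if `|B(y, n)| ≤ C (n+1)^D` for all `y, n` (real `C`, `D`), then at any vertex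
`x` no `c > 1` has `c^n ≤ |B(x, n)|` eventually — since `C (n+1)^D ≤ max(C,1) (n+1)^⌈D⌉ ≤ (2n+1)^{⌈D⌉+1} < c^n` for large `n`
(tree `eventually_pow_lt_const_pow`).  (A vertex is needed: on the empty graph `HasExponentialGrowth` holds vacuously.)
[cite: LyonsPeres2016, §6.1 (growth of balls)] -/
theorem not_hasExponentialGrowth_of_polynomialGrowth {V : Type} (G : SimpleGraph V) (x : V)
    (hpoly : ∃ C D : ℝ, ∀ (y : V) (n : ℕ), (ballVolume G y n : ℝ) ≤ C * ((n : ℝ) + 1) ^ D) :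
    ¬ HasExponentialGrowth G := by
  rintro hexp
  obtain ⟨C, D, hCD⟩ := hpoly
  obtain ⟨c, hc, hev⟩ := hexp x
  set k : ℕ := ⌈D⌉₊ with hk
  set C' : ℝ := max C 1 with hC'
  have hC'0 : 0 ≤ C' := le_trans zero_le_one (le_max_right _ _)
  have h1 : ∀ n : ℕ, (ballVolume G x n : ℝ) ≤ C' * ((n : ℝ) + 1) ^ k := by
    intro n
    have hn0 : (0 : ℝ) ≤ (n : ℝ) + 1 := by positivity
    have hn1 : (1 : ℝ) ≤ (n : ℝ) + 1 := by
      have := (Nat.cast_nonneg n : (0 : ℝ) ≤ n); linarith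
    have hpow : ((n : ℝ) + 1) ^ D ≤ ((n : ℝ) + 1) ^ (k : ℝ) :=
      Real.rpow_le_rpow_of_exponent_le hn1 (Nat.le_ceil D)
    rw [Real.rpow_natCast] at hpow
    calc (ballVolume G x n : ℝ) ≤ C * ((n : ℝ) + 1) ^ D := hCD x n
      _ ≤ C' * ((n : ℝ) + 1) ^ D := mul_le_mul_of_nonneg_right (le_max_left _ _) (Real.rpow_nonneg hn0 _)
      _ ≤ C' * ((n : ℝ) + 1) ^ k := mul_le_mul_of_nonneg_left hpow hC'0
  have h2 : ∀ᶠ n : ℕ in atTop, C' * ((n : ℝ) + 1) ^ k < c ^ n := by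
    have hA := eventually_pow_lt_const_pow (k + 1) hc
    have hB : ∀ᶠ n : ℕ in atTop, C' ≤ 2 * (n : ℝ) + 1 := by
      obtain ⟨N, hN⟩ := exists_nat_ge C'
      filter_upwards [eventually_ge_atTop N] with n hn
      have : (N : ℝ) ≤ n := by exact_mod_cast hn
      linarith
    filter_upwards [hA, hB] with n hA hB
    have hn0 : (0 : ℝ) ≤ (n : ℝ) + 1 := by positivity
    have hle : (n : ℝ) + 1 ≤ 2 * n + 1 := by
      have := (Nat.cast_nonneg n : (0 : ℝ) ≤ n); linarith
    calc C' * ((n : ℝ) + 1) ^ k ≤ (2 * n + 1) * (2 * (n : ℝ) + 1) ^ k :=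
          mul_le_mul hB (pow_le_pow_left₀ hn0 hle k) (by positivity) (by positivity)
      _ = (2 * (n : ℝ) + 1) ^ (k + 1) := by ring
      _ < c ^ n := by exact_mod_cast hA
  obtain ⟨n, hn1, hn2⟩ := (hev.and h2).exists
  linarith [h1 n]

/-! ## §2 The conjecture ⇔ its C3 residue; C3 ⇒ C2 -/

/-- **Conjecture 4 follows from its amenable–subexponential residue**: split on `HasExponentialGrowth G` — Hutchcroft 2016 in the exponential
case (`conj4_case_exponentialGrowth`), the residue in the other case, where `G` is amenable by Lyons–Peres §6.1
(`hasExponentialGrowth_of_not_isGraphAmenable`). [cite: Hutchcroft2016, Thm. 1] [cite: LyonsPeres2016, §6.1 (p. 279)] -/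
theorem conj4_of_conj4_amenableSubexponential (h : BenjaminiSchramm1996_conj4_amenableSubexponential) :
    BenjaminiSchramm1996_conj4 := by
  intro V G _ hc hq x hpc
  by_cases hg : HasExponentialGrowth G
  · exact conj4_case_exponentialGrowth G hc hq hg x hpc
  · have ha : IsGraphAmenable G := by
      by_contra hna
      exact hg (hasExponentialGrowth_of_not_isGraphAmenable G hq hna)
    exact h G hc hq ha hg x hpc

/-- The residue is a special case of the conjecture (drop the two extra hypotheses). [cite: BenjaminiSchramm1996, Conj. 4] -/
theorem conj4_amenableSubexponential_of_conj4 (h : BenjaminiSchramm1996_conj4) :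
    BenjaminiSchramm1996_conj4_amenableSubexponential :=
  fun G _ hc hq _ _ x hpc => h G hc hq x hpc

/-- **THEOREM: Benjamini–Schramm's Conjecture 4 is EQUIVALENT to its amenable–subexponential residue** (class C3) — what remains open
after Hutchcroft 2016 is exactly the amenable quasi-transitive graphs without exponential growth.
[cite: BenjaminiSchramm1996, Conj. 4] [cite: Hutchcroft2016, Thm. 1] [cite: LyonsPeres2016, §6.1 (p. 279)] -/
theorem conj4_iff_amenableSubexponential :
    BenjaminiSchramm1996_conj4 ↔ BenjaminiSchramm1996_conj4_amenableSubexponential :=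
  ⟨conj4_amenableSubexponential_of_conj4, conj4_of_conj4_amenableSubexponential⟩

/-- **C3 ⇒ C2**: the residue implies the polynomial-growth spelling (uniform polynomial growth ⇒ no exponential growth ⇒ amenable).
The converse is not claimed (quasi-transitive graphs of intermediate growth lie in C3 ∖ C2).
[cite: LyonsPeres2016, §6.1 (p. 279)] [cite: HermonHutchcroft2021, §1] -/
theorem conj4_polynomialGrowth_of_conj4_amenableSubexponential (h : BenjaminiSchramm1996_conj4_amenableSubexponential) :
    BenjaminiSchramm1996_conj4_polynomialGrowth := by
  intro V G _ hc hq hpoly x hpc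
  have hg : ¬ HasExponentialGrowth G := not_hasExponentialGrowth_of_polynomialGrowth G x hpoly
  have ha : IsGraphAmenable G := by
    by_contra hna
    exact hg (hasExponentialGrowth_of_not_isGraphAmenable G hq hna)
  exact h G hc hq ha hg x hpc

/-- C2 is a special case of the conjecture. [cite: BenjaminiSchramm1996, Conj. 4] -/
theorem conj4_polynomialGrowth_of_conj4 (h : BenjaminiSchramm1996_conj4) : BenjaminiSchramm1996_conj4_polynomialGrowth :=
  conj4_polynomialGrowth_of_conj4_amenableSubexponential (conj4_amenableSubexponential_of_conj4 h)

end Summit.CriticalPhenomena.PercolationContinuityZ3.Theorems.Transplant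

end
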